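import Summits.QuantumFields.YangMills.Theorems.BalabanUVNodesN10AtRecord11B13WalksRefHolo
import Literature.MathematicalPhysics.QuantumFieldTheory.Balaban1983to89.B13ConditioningBlockWalks

/-!
# BalabanUVNodes ∕ N10 AT NODE 00's [B13] GROUP OF RECORD, CONDITIONED-BLOCKS EDITION — NODE A's per-term rung `TermWalksRef`, the
# complex symmetry `hAs` and the σ-holomorphy `hAhol ∕ hGhol` of the three kernels ALL READ OFF ONE OPERATOR `K = C*Δ_k(σ,𝐔,𝐉)C` per term
# (the twin of `…N10AtRecord11B13WalksRefHolo.b13LeafOfRecord_of_located_walksRefHolo`, p473615, over this seat's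
# `Literature/…/B13ConditioningBlockWalks`; Track A, DAG node N10 [B13]; seat `pub-ymgap-dag-n10-c` g3, module 18)

HONEST FRAMING.  Count-neutral kernel bookkeeping: exactly `N10AtRecord11B13WalksRefHolo.b13LeafOfRecord_of_located_walksRefHolo` (the [B13]
leaf `Node00.B13LeafOfRecord θ lam` at def-B13's objects of record `WtOfRecord θ lam` ∕ `c13OfRecord θ lam` from the Lemma 1–2 located
inputs + NODE A's data on the terms of record + the dictionary + the numbers) with NODE A's FOUR per-term kernel hypotheses `hwalks`
(`TermWalksRef (𝒦 Z t) rf`: THREE joint walk expansions — of the local factor `L`, of the full precision `P`, of the term precision `A2` —,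
TWO reference positivities, far-ness and multiplicity of both location maps), `hAs` (complex symmetry of `A2(σ,u)`), `hAhol`, `hGhol`
(σ-holomorphy of `A2`, `G2` on the open `e^{κ₁⁺}`-polydisc) REPLACED by the data of ONE operator family `KK Z t (σ,u)` on the term's bond set
`Λ ⊕ C₀` — print's `C*Δ_k(σ(Z),𝐔,𝐉)C` after the conditioning (2.5)–(2.6) (interior `Z₀`-bonds `inl`, exterior `inr`; the tree's block model
`B13Sect2Statements`, `B13Term214.Gamma214`): the BLOCK READING of the three kernels (`hKA2 : A2 = K.toBlocks₁₁`, `hKG2 : G2 = fromCols 0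
K.toBlocks₁₂ · invSqrt K`, `hKloc : locΛ = locN ∘ inl`, `hKX : X ≠ ∅`), ONE joint walk expansion of `K` through `X` at the reference package's
full-precision letters (`hKexp`), ONE `m₀`-positivity of `Re K(0,0)` (`hKacc`), far-ness and multiplicity of the ONE location map (`hKfar`,
`hKmult`, `hKdim`), complex symmetry of `K(σ,u)` (`hKsym`) and entrywise σ-holomorphy of `K` (`hKhol`), plus seven DOMINATIONS inside the
package (`rf.ε_L, rf.ε_A ≤ rf.ε_P`, `rf.κ_L, rf.κ_A ≤ rf.κ_P`, `rf.K̄_P ≤ rf.K̄_L, rf.K̄_A`, `rf.m_{A,0} ≤ rf.m₀`: the package reads all three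
slots off the one expansion).  DERIVED inside, by name: `hwalks` = `B13ConditioningBlockWalks.termWalksRef_of_conditionedBlocks_at`; `hAs` =
`isSymm_toBlocks₁₁`; `hAhol` = `differentiableOn_toBlocks₁₁_apply`; `hGhol` = `differentiableOn_offBlock_mul_invSqrt_apply` on the sup-norm
ball (`setOf_forall_mem_ball_eq_ball`) with the uniform `m₀/2`-accretivity of `K` on polydisc × `R₁`-ball supplied by
`accretive_of_conditionedBlocks_at` from the SAME expansion + positivity under print's two perturbative thresholds `hPσ hP₁` (already
binders).  Everything else verbatim and in the same order, same conclusion `B13LeafOfRecord θ lam`.  WHAT REMAINS BY ASSERTION for N10's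
Lemma-3 side after this file: per term, ONE joint walk expansion with k-, history- and torus-uniform constants at complex backgrounds, ONE
positivity at `(U′,0)`, complex symmetry and σ-holomorphy of print's single named operator `C*Δ_k(σ,𝐔,𝐉)C` ([13] Thms 3.10 ∕ 3.12 for the
operators determining `Δ_k`, s-decorated by (1.11) = `B13Eq111SDecoupling`, sandwiched by the real local `C` = `B13JointWalkExpansionAlgebra
.jointWalkExpansion_mul` — NODE A ∕ in-edge N06 s4 ∕ the (D4) owner; NOT supplied), `hlin` (definitional), the dictionary `hT₃`, three
measurabilities; the Lemma 1–2 located inputs, the in-edges (1.24)∕(1.30), the numbers; the LAW layer for the layer's non-degeneracy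
(vacuous at a layer with empty spaces).  Print decorates the three operator arguments of `G` in (2.8) SEPARATELY; the tree's (2.14) reading
takes inverse and square root AFTER decoration — under that declared reading the block form is literal (module 17's header).  N10 NOT discharged;
nothing of Bałaban's asserted; one finite four-torus programme at fixed ε per run; nothing continuum ∕ ℝ⁴ ∕ OS ∕ mass-gap ∕ Clay.  0 `sorry`,
0 `def`, standard axioms.  Filed `--supports` K1′ «StabilityBAtRecordR12e» (stmt-QuantumFields-19903, `--as helper`) of route «BalabanUVNodes» (rev 15).

WHAT THIS FILE PROVES.  §0 term-level consumer forms `isSymm_A2_∕differentiableOn_A2_∕differentiableOn_G2_of_conditionedBlocks`;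
§1 `b13LeafOfRecord_of_located_conditionedBlocksHolo` — g2's proof with the four NODE-A letters supplied by §0 ∕ module 17 at the one operator.
-/

noncomputable section

namespace Summit.QuantumFields.YangMills.BalabanUVNodes.N10AtRecord11B13WalksBlockRefHolo

open Literature.MathematicalPhysics.QuantumFieldTheory.Balaban1983to89
open Literature.MathematicalPhysics.QuantumFieldTheory.Balaban1983to89.DagBinding
open Literature.MathematicalPhysics.QuantumFieldTheory.Balaban1983to89.Node00
open Literature.MathematicalPhysics.QuantumFieldTheory.Balaban1983to89.B13Lemma3Torus (TwoTorusStep)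
open Literature.MathematicalPhysics.QuantumFieldTheory.Balaban1983to89.B13Lemma3TorusSocket (TermDomination Lemma3Numerics)
open Literature.MathematicalPhysics.QuantumFieldTheory.Balaban1983to89.B13Lemma3TorusData
open Metric
open Literature.MathematicalPhysics.QuantumFieldTheory.Balaban1983to89.B16Absorption (pbox)
open Literature.MathematicalPhysics.QuantumFieldTheory.Balaban1983to89.TreeLengthTorus
open Literature.MathematicalPhysics.QuantumFieldTheory.Balaban1983to89.TreeLengthTorusGeometry
open Literature.MathematicalPhysics.QuantumFieldTheory.Balaban1983to89.TreeLengthTorusTransfer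
open Literature.MathematicalPhysics.QuantumFieldTheory.Balaban1983to89.B12TreeDecay (kappa₀ K₀)
open Literature.MathematicalPhysics.QuantumFieldTheory.Balaban1983to89.B13PkScaling (Qop scaled)
open Literature.MathematicalPhysics.QuantumFieldTheory.Balaban1983to89.B13Bound143 (invTau R12)
open Literature.MathematicalPhysics.QuantumFieldTheory.Balaban1983to89.B13Term214 (term214 SepHolOn core214 F214)
open Literature.MathematicalPhysics.QuantumFieldTheory.Balaban1983to89.B13Lemma3TorusTerms (terms Z0)
open Literature.MathematicalPhysics.QuantumFieldTheory.Balaban1983to89.B5TorusCover (UT)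
open Literature.MathematicalPhysics.QuantumFieldTheory.Balaban1983to89.B13TermWalkData (TermKernels)
open Literature.MathematicalPhysics.QuantumFieldTheory.Balaban1983to89.NodeOLettersOfWalksAcross (WalkPackage TermWalks)
open Literature.MathematicalPhysics.QuantumFieldTheory.Balaban1983to89.NodeOLettersOfWalksPerturbative
  (RefPackage TermWalksRef termWalks_of_ref_thresholds)
open Literature.MathematicalPhysics.QuantumFieldTheory.Balaban1983to89.NodeOLettersOfWalksAcross (WalkPackage)
open Literature.MathematicalPhysics.QuantumFieldTheory.Balaban1983to89.B13NodeTorusWalks (exchange_of_thresholds)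
open Literature.MathematicalPhysics.QuantumFieldTheory.Balaban1983to89.B13NodeTorusWalksHolo (b13Leaf_twoTorus_walksRefHolo)
open Literature.MathematicalPhysics.QuantumFieldTheory.Balaban1983to89.B13JointWalkExpansion (JointWalkExpansion)
open Literature.MathematicalPhysics.QuantumFieldTheory.Balaban1983to89.B13Sqrt27Accretive (invSqrt)
open Literature.MathematicalPhysics.QuantumFieldTheory.Balaban1983to89.B9Thm37GlueTorus (tdist1)
open Literature.MathematicalPhysics.QuantumFieldTheory.Balaban1983to89.B13ConditioningBlockWalks
  (termWalksRef_of_conditionedBlocks_at isSymm_toBlocks₁₁ differentiableOn_toBlocks₁₁_apply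
    differentiableOn_offBlock_mul_invSqrt_apply setOf_forall_mem_ball_eq_ball accretive_of_conditionedBlocks_at)
open scoped Matrix

/-! ## §0. Term-level consumer forms: the three kernel letters of a term READ OFF its one operator -/
section TermLetters

variable {cp : B13.Consts} {d N' : ℕ} {ν : ℕ} {Nf : Fin ν → ℕ} [∀ i, NeZero (Nf i)]
variable {E : Type*} [NormedAddCommGroup E] [NormedSpace ℂ E]
variable {𝒦 : TermKernels cp d N' ν Nf E}
variable {K : (TPt d N' → ℂ) → E → Matrix (𝒦.Λ ⊕ 𝒦.C₀) (𝒦.Λ ⊕ 𝒦.C₀) ℂ}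

/-- **`hAs` OF A TERM FROM ITS ONE OPERATOR**: under the block reading `A2 = K.toBlocks₁₁`, complex symmetry of `K(σ,u)` gives
that of the term precision `A2(σ,u)` (`B13ConditioningBlockWalks.isSymm_toBlocks₁₁`). [cite: Balaban1988RG2Cluster, (2.5) p.12, (2.14) p.15] -/
theorem isSymm_A2_of_conditionedBlocks (hA2 : ∀ σ u, 𝒦.A2 σ u = (K σ u).toBlocks₁₁) {σ : TPt d N' → ℂ} {u : E}
    (hK : (K σ u).IsSymm) : (𝒦.A2 σ u).IsSymm := by
  rw [hA2]
  exact isSymm_toBlocks₁₁ hK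

/-- **`hAhol` OF A TERM FROM ITS ONE OPERATOR**: under the block reading, entrywise σ-holomorphy of `K(·,u)` on a set gives that of
`A2(·,u)` (`B13ConditioningBlockWalks.differentiableOn_toBlocks₁₁_apply`). [cite: Balaban1988RG2Cluster, (2.5) p.12, (2.14) p.15] -/
theorem differentiableOn_A2_of_conditionedBlocks [NeZero N'] (hA2 : ∀ σ u, 𝒦.A2 σ u = (K σ u).toBlocks₁₁) {u : E}
    {U : Set (TPt d N' → ℂ)} (hKhol : ∀ k l, DifferentiableOn ℂ (fun σ => K σ u k l) U) (i j : 𝒦.Λ) :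
    DifferentiableOn ℂ (fun σ => 𝒦.A2 σ u i j) U := by
  have e : (fun σ => 𝒦.A2 σ u i j) = fun σ => (K σ u).toBlocks₁₁ i j := funext fun σ => by rw [hA2]
  rw [e]
  exact differentiableOn_toBlocks₁₁_apply (K := fun σ => K σ u) hKhol i j

/-- **`hGhol` OF A TERM FROM ITS ONE OPERATOR**: under the block reading `G2 = fromCols 0 K.toBlocks₁₂ · invSqrt K`, ONE joint walk
expansion of `K` through `X` at a reference package's full-precision letters, `m₀`-positivity of `Re K(0,0)`, far-ness, multiplicity,
dimension, a radius `0 ≤ R₁ < R` with print's two perturbative thresholds, a configuration `‖u‖ ≤ R₁` and entrywise σ-holomorphy of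
`K(·,u)` on the open `e^{κ₁}`-polydisc give σ-holomorphy of every entry of the Γ-kernel `G2(·,u)` there — the uniform `m₀/2`-accretivity
of `K` on polydisc × ball (`B13ConditioningBlockWalks.accretive_of_conditionedBlocks_at`) feeds the holomorphy of the square root (2.7)
(`differentiableOn_offBlock_mul_invSqrt_apply`, on the sup-norm ball = the polydisc, `setOf_forall_mem_ball_eq_ball`).
[cite: Balaban1988RG2Cluster, (2.5)–(2.7) pp.12–13, (2.14) p.15, (2.16) p.16; Balaban1985BackgroundPropagators, Thm 3.10 p.416, Thm 3.12 p.423] -/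
theorem differentiableOn_G2_of_conditionedBlocks [NeZero N'] [Fintype 𝒦.C₀] [DecidableEq 𝒦.C₀]
    (hG2 : ∀ σ u, 𝒦.G2 σ u = Matrix.fromCols (0 : Matrix 𝒦.Λ 𝒦.Λ ℂ) (K σ u).toBlocks₁₂ * invSqrt (K σ u))
    (rf : RefPackage) (hrf : rf.Admissible)
    {W : Type} {T : W → (TPt d N' → ℂ) → E → Matrix (𝒦.Λ ⊕ 𝒦.C₀) (𝒦.Λ ⊕ 𝒦.C₀) ℂ}
    {SX : Set W} {A : W → ℝ} {D : W → UT Nf → UT Nf → ℝ} {ρ : ℝ}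
    (hK : JointWalkExpansion cp 𝒦.locN 𝒦.locN K 𝒦.X rf.R rf.εP rf.kapP rf.KbarP T SX A D ρ)
    (hacc : ∀ v : 𝒦.Λ ⊕ 𝒦.C₀ → ℂ, rf.m₀ * ∑ i, ‖v i‖ ^ 2 ≤ (∑ i, star (v i) * (K 0 0 *ᵥ v) i).re)
    (hfar : ∀ k : 𝒦.Λ ⊕ 𝒦.C₀, ∀ z ∈ 𝒦.X, rf.Rσ ≤ tdist1 Nf (𝒦.locN k) z)
    (hmult : ∀ x : UT Nf, (Finset.univ.filter fun k : 𝒦.Λ ⊕ 𝒦.C₀ => 𝒦.locN k = x).card ≤ rf.nB)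
    (hdim : ν ≤ rf.dm) {R₁ : ℝ} (hR₁ : 0 ≤ R₁) (hR₁R : R₁ < rf.R)
    (hPσ : 8 * rf.KbarP * rf.cV₀ * Real.exp (-(rf.εP * rf.Rσ)) ≤ rf.m₀) (hP₁ : 8 * rf.KbarP * rf.cV₀ * R₁ ≤ rf.m₀ * rf.R)
    {u : E} (hu : ‖u‖ ≤ R₁)
    (hKhol : ∀ k l, DifferentiableOn ℂ (fun σ => K σ u k l)
      {σ : TPt d N' → ℂ | ∀ j, σ j ∈ Metric.ball (0 : ℂ) (Real.exp cp.κ₁)}) (i : 𝒦.Λ) (j : 𝒦.Λ ⊕ 𝒦.C₀) :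
    DifferentiableOn ℂ (fun σ => 𝒦.G2 σ u i j) {σ : TPt d N' → ℂ | ∀ j, σ j ∈ Metric.ball (0 : ℂ) (Real.exp cp.κ₁)} := by
  have e : (fun σ => 𝒦.G2 σ u i j) = fun σ =>
      (Matrix.fromCols (0 : Matrix 𝒦.Λ 𝒦.Λ ℂ) (K σ u).toBlocks₁₂ * invSqrt (K σ u)) i j := funext fun σ => by rw [hG2]
  have hm : 0 < rf.m₀ / 2 := by linarith [hrf.hm₀]
  rw [e, setOf_forall_mem_ball_eq_ball (Real.exp_pos _)]
  refine differentiableOn_offBlock_mul_invSqrt_apply (fun σ => K σ u) hm (fun σ hσ v => ?_) (fun k l => ?_) i j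
  · have hσ' : ∀ j, ‖σ j‖ ≤ Real.exp cp.κ₁ := fun j => by
      rw [← setOf_forall_mem_ball_eq_ball (Real.exp_pos _)] at hσ
      have hj := hσ j
      rw [Metric.mem_ball, dist_zero_right] at hj
      exact hj.le
    exact accretive_of_conditionedBlocks_at rf hrf hK hacc hfar hmult hdim hR₁ hR₁R hPσ hP₁ σ hσ' hu v
  · have hk := hKhol k l
    rwa [setOf_forall_mem_ball_eq_ball (Real.exp_pos _)] at hk

end TermLetters
/-! ## §1. THE CONDITIONED-BLOCKS EDITION OF THE JUNCTION AT THE GROUP OF RECORD (Stage 3) -/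

section Group

variable (θ : Stage3Params) (lam : ResidB13 θ)

-- the junction elaborates ≈ 170 binders and a 150-argument `exact`; twice the default budget (as in the sibling N10 junction files)
set_option maxHeartbeats 400000 in
open Classical in
/-- **THE [B13] LEAF AT NODE 00's GROUP OF RECORD WITH NODE A's KERNEL LETTERS READ OFF ONE OPERATOR PER TERM.**  Exactly
`N10AtRecord11B13WalksRefHolo.b13LeafOfRecord_of_located_walksRefHolo` (p473615; same conclusion `B13LeafOfRecord θ lam`, binders in the
same order) except the module header's trade: `hwalks hAs hAhol hGhol` REMOVED; in their place (after the package's thresholds) the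
CONDITIONED OPERATOR `KK Z t` of every term with its block reading `hKA2 hKG2 hKloc hKX`, ONE joint walk expansion `hKexp` at
`(rf.R, rf.ε_P, rf.κ_P, rf.K̄_P)`, ONE reference positivity `hKacc`, geometry `hKfar hKmult hKdim`, complex symmetry `hKsym`, σ-holomorphy
`hKhol`, and the seven dominations inside `rf`.  The four removed letters are DERIVED by `B13ConditioningBlockWalks`
(`termWalksRef_of_conditionedBlocks_at`, `isSymm_toBlocks₁₁`, `differentiableOn_toBlocks₁₁_apply`,
`differentiableOn_offBlock_mul_invSqrt_apply` + `accretive_of_conditionedBlocks_at` + `setOf_forall_mem_ball_eq_ball`).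
[cite: Balaban1988RG2Cluster, Lemma 1 p.9, Lemma 2 p.11, Lemma 3 p.20, (2.5)–(2.7) pp.12–13, p.15, (2.14)–(2.26) pp.15–17; Balaban1985BackgroundPropagators, Thm 3.10 p.416, Thm 3.12 p.423] -/
theorem b13LeafOfRecord_of_located_conditionedBlocksHolo
    (hN12 : 12 ≤ (θ.ℓ₆ + 1) * (lam.n + 1))
    -- (1) LEMMA 1: [I]'s block geometry of the (1.33) index families of the layer
    (dist : TDom 4 ((θ.ℓ₆ + 1) * (lam.n + 1)) → TPt 4 ((θ.ℓ₆ + 1) * (lam.n + 1)) → (j : ℕ) →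
      TPt 4 ((θ.ℓ₆ + 1) ^ (lam.k - j) * ((θ.ℓ₆ + 1) * (lam.n + 1))) → ℝ) {K K' : ℝ}
    (hS0Y : ∀ Y, ∀ a ∈ lam.S0 Y,
      (pbox (fun i => natLift a i - (5 : ℕ)) (fun i => natLift a i + 1 + (5 : ℕ))).image (proj ((θ.ℓ₆ + 1) * (lam.n + 1))) ⊆ Y.1)
    (hFsub : ∀ Y a, lam.F Y a ⊆
      (pbox (fun i => natLift a i - (5 : ℕ)) (fun i => natLift a i + 1 + (5 : ℕ))).image (proj ((θ.ℓ₆ + 1) * (lam.n + 1))) \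
        (pbox (fun i => natLift a i - (4 : ℕ)) (fun i => natLift a i + 1 + (4 : ℕ))).image (proj ((θ.ℓ₆ + 1) * (lam.n + 1))))
    (hSq : ∀ Y, ∀ a ∈ lam.S0 Y, ∀ j, lam.Sq Y a j ⊆
      (Finset.univ : Finset (TPt 4 ((θ.ℓ₆ + 1) ^ (lam.k - j) * ((θ.ℓ₆ + 1) * (lam.n + 1))))).filter
        (fun q => tcoarse ((θ.ℓ₆ + 1) ^ (lam.k - j)) ((θ.ℓ₆ + 1) * (lam.n + 1)) q ∈
          (pbox (fun i => natLift a i - (2 : ℕ)) (fun i => natLift a i + 1 + (2 : ℕ))).image (proj ((θ.ℓ₆ + 1) * (lam.n + 1)))))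
    (hScY : ∀ Y, lam.Sc Y ⊆ Y.1)
    (hdist0 : ∀ Y a j q, 0 ≤ lam.c.δ₀ * dist Y a j q)
    (hdist : ∀ Y a j (n : ℕ) q, q ∉ (pbox (fun i => (((θ.ℓ₆ + 1) ^ (lam.k - j) : ℕ) : ℤ) * natLift a i - (n + 1 : ℕ))
      (fun i => (((θ.ℓ₆ + 1) ^ (lam.k - j) : ℕ) : ℤ) * natLift a i + 2 * (((θ.ℓ₆ + 1) ^ (lam.k - j) : ℕ) : ℤ) - 1 + (n + 1 : ℕ))).image
        (proj ((θ.ℓ₆ + 1) ^ (lam.k - j) * ((θ.ℓ₆ + 1) * (lam.n + 1)))) → lam.c.δ₀ * lam.c.M * ((n : ℝ) + 1) ≤ lam.c.δ₀ * dist Y a j q)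
    (hSX : ∀ Y a j q, lam.SX Y a j q ⊆ (tcubeSys 4 ((θ.ℓ₆ + 1) ^ (lam.k - j) * ((θ.ℓ₆ + 1) * (lam.n + 1)))).above q)
    (hSX' : ∀ Y a j q, lam.SX' Y a j q ⊆ (tcubeSys 4 ((θ.ℓ₆ + 1) ^ (lam.k - j) * ((θ.ℓ₆ + 1) * (lam.n + 1)))).above q)
    (hX0 : ∀ Y, ∀ a ∈ lam.Sc Y, ∀ j ∈ Finset.range (lam.k + 1), ∀ q ∈ lam.Sq' Y a j, ∀ x ∈ lam.SX' Y a j q,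
      x.1.image (tcoarse ((θ.ℓ₆ + 1) ^ (lam.k - j)) ((θ.ℓ₆ + 1) * (lam.n + 1))) ⊆ Y.1)
    -- (1) LEMMA 1: per-term analyticity on (1.34)
    (hAnT : ∀ Y, ∀ a ∈ lam.S0 Y, ∀ X ∈ (lam.F Y a).powerset, ∀ j ∈ Finset.range (lam.k + 1), ∀ q ∈ lam.Sq Y a j,
      ∀ x ∈ lam.SX Y a j q, AnalyticOnNhd ℂ (lam.T Y a X j q x) (lam.sp1 Y))
    (hAnT' : ∀ Y, ∀ a ∈ lam.Sc Y, ∀ j ∈ Finset.range (lam.k + 1), ∀ q ∈ lam.Sq' Y a j, ∀ x ∈ lam.SX' Y a j q,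
      AnalyticOnNhd ℂ (lam.T' Y a j q x) (lam.sp1 Y))
    -- (1) LEMMA 1: thresholds and restrictions on the residual constants
    (hK : 0 ≤ K) (hK' : 0 ≤ K') (hκ : 0 ≤ lam.c.κ) (hδ1 : lam.c.δ < 1) (hδκ : 1 ≤ lam.c.δ * lam.c.κ)
    (hκ126 : kappa₀ 64 8 ≤ lam.c.κ) (hκ126' : kappa₀ 64 8 ≤ lam.c.δ * lam.c.κ)
    (hκ₁ : 1 + 2 * Real.log (8 * 12 ^ 3) ≤ lam.c.κ₁) (hκ₁' : 2 + 16 * Real.log 128 ≤ lam.c.κ₁)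
    (hδ₀M : 10 * Real.exp (-1) ≤ lam.c.δ₀ * lam.c.M) (hδ₀M5 : 2 * Real.log 5 ≤ lam.c.δ₀ * lam.c.M)
    (hR8 : (1 - lam.c.δ) * lam.c.κ ≤ (1 / 4) * (lam.c.κ₁ - 1)) (hR9 : (1 - 2 * lam.c.δ) * lam.c.κ ≤ (1 / 16) * lam.c.κ₁)
    -- (1) LEMMA 1: per-term (1.24), (1.30) by reference to [I] (3.54), (3.17), [15] Prop. 4, [13] (3.108); the constants with headroom (1 − θ₁)
    (h124 : ∀ Y φ, φ ∈ lam.sp1 Y → ∀ a ∈ lam.S0 Y, ∀ X ∈ (lam.F Y a).powerset, ∀ j ∈ Finset.range (lam.k + 1), ∀ q ∈ lam.Sq Y a j,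
      ∀ x ∈ lam.SX Y a j q,
        ‖lam.T Y a X j q x φ‖ ≤ K * (((θ.ℓ₆ + 1 : ℕ) : ℝ) ^ j * (((θ.ℓ₆ + 1 : ℕ) : ℝ) ^ lam.k)⁻¹) ^ 5 *
          Real.exp (-(lam.c.κ₁ - 1) *
            (((Y.1 \ (pbox (fun i => natLift a i - (5 : ℕ)) (fun i => natLift a i + 1 + (5 : ℕ))).image
              (proj ((θ.ℓ₆ + 1) * (lam.n + 1)))).card : ℝ) + X.card)) *
          Real.exp (-(lam.c.κ * torusTreeLen x.1)))
    (h130 : ∀ Y φ, φ ∈ lam.sp1 Y → ∀ a ∈ lam.Sc Y, ∀ j ∈ Finset.range (lam.k + 1), ∀ q ∈ lam.Sq' Y a j,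
      ∀ x ∈ lam.SX' Y a j q,
        ‖lam.T' Y a j q x φ‖ ≤ K' * Real.exp (-(1 / 2) * (lam.c.δ₀ * lam.c.M) * (((θ.ℓ₆ + 1 : ℕ) : ℝ) ^ j * (((θ.ℓ₆ + 1 : ℕ) : ℝ) ^ lam.k)⁻¹)⁻¹
            - (1 / 2) * lam.c.δ₀ * dist Y a j q) *
          Real.exp (-(lam.c.κ₁ - 1) * ((Y.1 \ x.1.image (tcoarse ((θ.ℓ₆ + 1) ^ (lam.k - j)) ((θ.ℓ₆ + 1) * (lam.n + 1)))).card : ℝ)) *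
          Real.exp (-(lam.c.κ * torusTreeLen x.1)))
    {θ₁ : ℝ} (hθ₁0 : 0 ≤ θ₁) (hθ₁1 : θ₁ < 1)
    (hC : K * K₀ 64 8 * (2 * (6 * ((θ.ℓ₆ + 1 : ℕ) : ℝ)) ^ 4) * Real.exp 1 * Real.exp ((1 / 8) * lam.c.κ₁ * (12 ^ 4 - 1)) +
        2 * (64 * K') * K₀ 64 8 * 1344 ≤
      (1 - θ₁) * (lam.c.E₀ * lam.c.ε₁ * lam.c.C₁ * lam.c.M ^ lam.c.q * Real.exp (lam.c.C₂ * lam.c.κ₁)))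
    -- (2) LEMMA 2 (pp. 10–11): the curvature terms; the located per-term data of `B13Lemma2Torus.lemma2Printed_twoTorus'` for the layer's plaquette data
    (hGlAn : ∀ Y, AnalyticOnNhd ℂ (lam.Gl Y) (lam.sp1 Y))
    (hGl : ∀ Y φ, φ ∈ lam.sp1 Y → ‖lam.Gl Y φ‖ ≤ θ₁ * (lam.c.E₀ * lam.c.ε₁ * lam.c.C₁ * lam.c.M ^ lam.c.q * Real.exp (lam.c.C₂ * lam.c.κ₁)) *
      Real.exp (-((1 - 2 * lam.c.δ) * lam.c.κ * (tsys 4 ((θ.ℓ₆ + 1) * (lam.n + 1))).dj Y)))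
    (he : ∀ Y b, ‖lam.e Y b‖ ≤ 1) (hg : lam.g ≠ 0)
    {R K₂ : ℝ} {m₂ : ℕ} (hK₂ : 0 ≤ K₂) (hR : 0 < R) (hε3 : 3 * lam.c.ε₁ ≤ R)
    (hW : ∀ Y, ∀ i ∈ lam.s Y, ∀ φ ∈ lam.sp1 Y, AnalyticOnNhd ℂ (lam.Wf Y i φ) (ball 0 R))
    (hKW : ∀ Y, ∀ i ∈ lam.s Y, ∀ φ ∈ lam.sp1 Y, ∀ z ∈ ball (0 : lam.E) R,
      ‖lam.Wf Y i φ z‖ ≤ K₂ * Real.exp (-(lam.c.κ₁ - 1) * ((Y.1.card : ℝ) - 1)) * ‖z‖ ^ 3)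
    (hcard : ∀ Y, (lam.s Y).card ≤ m₂ * Y.1.card)
    (hsp : ∀ Y φ, φ ∈ lam.sp1 Y → ‖lam.g‖ * ‖lam.rd Y φ‖ < lam.c.ε₁)
    (hfloor : 27 * m₂ * K₂ * Real.exp (lam.c.κ₁ - 1) ≤ lam.c.C₃ * lam.c.M ^ 4 * Real.exp (lam.c.C₂ * lam.c.κ₁))
    (hAnP : ∀ Y, ∀ i ∈ lam.s Y, AnalyticOnNhd ℂ (fun φ => scaled lam.g (lam.Wf Y i φ) (lam.rd Y φ)) (lam.sp1 Y))
    (hG : ∀ Y, lam.GaugeInv (lam.V Y) ∧ lam.GaugeInv ((WtOfRecord θ lam).toStepData.quadForm Y) ∧ lam.GaugeInv (lam.Vpp Y))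
    -- (3) LEMMA 3 (pp. 14–20): the signs of (2.18)–(2.20), R12, |τ(Y)| ≥ 2, and the numerics bundle at ℓ = ½L
    (hL8 : 8 ≤ θ.ℓ₆ + 1) {a a₂ a₂' a₅ Aabs : ℝ} (hN : Lemma3Numerics (c13OfRecord θ lam) (lam.m₃ + 1) (((θ.ℓ₆ + 1 : ℕ) : ℝ) / 2) a a₂ a₂' a₅ Aabs)
    (h12 : R12 (c13OfRecord θ lam)) (hE : 0 < lam.c.E₀) (hε : 0 < lam.c.ε₁) (hC₁ : 0 < lam.c.C₁) (hα : 0 < lam.c.α₄)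
    (hM : 1 ≤ lam.c.M)
    (hτ2 : lam.c.E₀ * lam.c.ε₁ * lam.c.C₁ * lam.c.α₄⁻¹ * lam.c.M ^ lam.c.q * Real.exp (lam.c.C₂ * lam.c.κ₁) ≤ 1 / 2)
    -- (3) the Cauchy radius and the parameter domains (p. 15)
    -- the bigger σ-polydisc (a second constants record `cp` lending its `κ₁`; NODE A's kernels are tagged at `cp`) and a
    -- Cauchy radius `r ≤ 1`; the τ-regions are the open discs of radii `2|τ(Y)|` (chosen inside)
    (cp : B13.Consts) (hκp : lam.c.κ₁ < cp.κ₁) {r : ℝ} (hr : 0 < r) (hr1 : r ≤ 1)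
    -- (3) THE DICTIONARY: per term (𝐃, P) of every Z ∈ 𝐃_{k+1}, the kernel data `𝒦 Z t` on a site torus `UT Nf` with
    --     configuration space `E₃`, and the configuration `u = uOf Z t φ` of `φ ∈ sp2 Z`, of size ≤ α
    {ν : ℕ} {Nf : Fin ν → ℕ} [∀ i, NeZero (Nf i)]
    {E₃ : Type*} [NormedAddCommGroup E₃] [NormedSpace ℂ E₃]
    (𝒦 : TDom 4 (lam.n + 1) → Finset (TDom 4 ((θ.ℓ₆ + 1) * (lam.n + 1))) × Finset (TBond 4 (lam.m₃ + 1) ((θ.ℓ₆ + 1) * (lam.n + 1))) → TermKernels cp 4 (lam.n + 1) ν Nf E₃)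
    [∀ Z t, Fintype (𝒦 Z t).C₀] [∀ Z t, DecidableEq (𝒦 Z t).C₀]
    (uOf : (Z : TDom 4 (lam.n + 1)) → (t : Finset (TDom 4 ((θ.ℓ₆ + 1) * (lam.n + 1))) × Finset (TBond 4 (lam.m₃ + 1) ((θ.ℓ₆ + 1) * (lam.n + 1)))) → lam.Φ → E₃)
    {α : ℝ} (hαnn : 0 ≤ α) (huα : ∀ Z, ∀ t ∈ terms (θ.ℓ₆ + 1) (lam.m₃ + 1) Z, ∀ φ ∈ lam.sp2 Z, ‖uOf Z t φ‖ ≤ α)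
    -- (3) per term: parameter lists, the linear map Γ(σ), characteristic functions, potentials
    (lZ : TDom 4 (lam.n + 1) → Finset (TDom 4 ((θ.ℓ₆ + 1) * (lam.n + 1))) × Finset (TBond 4 (lam.m₃ + 1) ((θ.ℓ₆ + 1) * (lam.n + 1))) → List (TPt 4 (lam.n + 1)))
    (hlZ : ∀ Z, ∀ t ∈ terms (θ.ℓ₆ + 1) (lam.m₃ + 1) Z, (lZ Z t).Nodup ∧ (lZ Z t).toFinset = Z.1 \ tclosure (θ.ℓ₆ + 1) (lam.n + 1) (Z0 (lam.m₃ + 1) t))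
    (lD : TDom 4 (lam.n + 1) → Finset (TDom 4 ((θ.ℓ₆ + 1) * (lam.n + 1))) × Finset (TBond 4 (lam.m₃ + 1) ((θ.ℓ₆ + 1) * (lam.n + 1))) → List (TDom 4 ((θ.ℓ₆ + 1) * (lam.n + 1))))
    (hlD : ∀ Z, ∀ t ∈ terms (θ.ℓ₆ + 1) (lam.m₃ + 1) Z, (lD Z t).Nodup ∧ (lD Z t).toFinset = t.1)
    (Γm : (Z : TDom 4 (lam.n + 1)) → (t : Finset (TDom 4 ((θ.ℓ₆ + 1) * (lam.n + 1))) × Finset (TBond 4 (lam.m₃ + 1) ((θ.ℓ₆ + 1) * (lam.n + 1)))) → lam.Φ →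
      (TPt 4 (lam.n + 1) → ℂ) → ((𝒦 Z t).Λ ⊕ (𝒦 Z t).C₀ → ℝ) → ((𝒦 Z t).Λ → ℂ))
    (χY₀ χcP : (Z : TDom 4 (lam.n + 1)) → (t : Finset (TDom 4 ((θ.ℓ₆ + 1) * (lam.n + 1))) × Finset (TBond 4 (lam.m₃ + 1) ((θ.ℓ₆ + 1) * (lam.n + 1)))) →
      ((𝒦 Z t).Λ → ℝ) → ℝ)
    (hχ0 : ∀ Z t B, 0 ≤ χY₀ Z t B) (hχ1 : ∀ Z t B, χY₀ Z t B ≤ 1)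
    (Pl : (Z : TDom 4 (lam.n + 1)) → (t : Finset (TDom 4 ((θ.ℓ₆ + 1) * (lam.n + 1))) × Finset (TBond 4 (lam.m₃ + 1) ((θ.ℓ₆ + 1) * (lam.n + 1)))) → Finset (𝒦 Z t).Λ)
    (hPcard : ∀ Z, ∀ t ∈ terms (θ.ℓ₆ + 1) (lam.m₃ + 1) Z, (Pl Z t).card = t.2.card) {rP : ℝ} (hrP : 0 ≤ rP)
    (hχc : ∀ Z t B, χcP Z t B = ∏ b ∈ Pl Z t, (if rP ≤ |B b| then (1 : ℝ) else 0))
    (Dfam : TDom 4 (lam.n + 1) → Finset (TDom 4 ((θ.ℓ₆ + 1) * (lam.n + 1))) × Finset (TBond 4 (lam.m₃ + 1) ((θ.ℓ₆ + 1) * (lam.n + 1))) → Finset (TDom 4 ((θ.ℓ₆ + 1) * (lam.n + 1))))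
    (Vr : (Z : TDom 4 (lam.n + 1)) → (t : Finset (TDom 4 ((θ.ℓ₆ + 1) * (lam.n + 1))) × Finset (TBond 4 (lam.m₃ + 1) ((θ.ℓ₆ + 1) * (lam.n + 1)))) → lam.Φ →
      TDom 4 ((θ.ℓ₆ + 1) * (lam.n + 1)) → ((𝒦 Z t).Λ → ℝ) → ℂ)
    -- (3) THE LAYER's TERM IS (dominated by) THE (2.14) X-INTEGRAL OF NODE A's KERNELS at the configuration — the
    --     dictionary identification; termwise domination of H(Z) = Σ T₃ is then the theorem `termDomination_WtOfRecord`
    (hT₃ : ∀ Z, ∀ t ∈ terms (θ.ℓ₆ + 1) (lam.m₃ + 1) Z, ∀ φ ∈ lam.sp2 Z, ‖lam.T₃ Z t φ‖ ≤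
      ‖term214 r (lZ Z t) (lD Z t)
        (core214 (fun σ => (𝒦 Z t).A2 σ (uOf Z t φ)) (Γm Z t φ)
          (F214 t.2.card (χY₀ Z t) (χcP Z t) (Dfam Z t) (Vr Z t φ))) 0 0‖)
    -- (3) the record's objects behind the terms: bonds, cubes, the real field inside the configurations
    (ιb : (Z : TDom 4 (lam.n + 1)) → (t : Finset (TDom 4 ((θ.ℓ₆ + 1) * (lam.n + 1))) × Finset (TBond 4 (lam.m₃ + 1) ((θ.ℓ₆ + 1) * (lam.n + 1)))) → (𝒦 Z t).Λ → lam.Bond)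
    (hι : ∀ Z t, Function.Injective (ιb Z t)) (cube : lam.Bond → TPt 4 ((θ.ℓ₆ + 1) * (lam.n + 1)))
    (hQsupp : ∀ (Y : TDom 4 ((θ.ℓ₆ + 1) * (lam.n + 1))) φ b b', lam.Q Y φ b b' ≠ 0 → cube b ∈ Y.1 ∧ cube b' ∈ Y.1)
    {m' : ℕ} (hfibc : ∀ Z t (x : TPt 4 ((θ.ℓ₆ + 1) * (lam.n + 1))), (Finset.univ.filter fun j => cube (ιb Z t j) = x).card ≤ m')
    (emb : (Z : TDom 4 (lam.n + 1)) → (t : Finset (TDom 4 ((θ.ℓ₆ + 1) * (lam.n + 1))) × Finset (TBond 4 (lam.m₃ + 1) ((θ.ℓ₆ + 1) * (lam.n + 1)))) → lam.Φ →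
      ((𝒦 Z t).Λ → ℝ) → lam.Φ)
    (hBv : ∀ Z t φ B b, lam.Bv (emb Z t φ B) (ιb Z t b) = (B b : ℂ))
    (hBv0 : ∀ Z t φ B b', b' ∉ Set.range (ιb Z t) → lam.Bv (emb Z t φ B) b' = 0)
    (hVr : ∀ Z, ∀ t ∈ terms (θ.ℓ₆ + 1) (lam.m₃ + 1) Z, ∀ φ ∈ lam.sp2 Z, ∀ Y ∈ Dfam Z t, ∀ B,
      emb Z t φ B ∈ lam.sp1 Y → Vr Z t φ Y B = lam.V Y (emb Z t φ B))
    (hχsupp : ∀ Z, ∀ t ∈ terms (θ.ℓ₆ + 1) (lam.m₃ + 1) Z, ∀ φ ∈ lam.sp2 Z, ∀ B, χY₀ Z t B ≠ 0 → ∀ Y ∈ Dfam Z t,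
      emb Z t φ B ∈ lam.sp1 Y)
    -- (3) measurability of the layer's `χ_{k,Y₀}`, potentials, small-field region in the bond variables
    (hχm : ∀ Z t, Measurable (χY₀ Z t)) (hVm : ∀ Z t φ Y, Measurable (Vr Z t φ Y))
    (hsmallm : ∀ Z t φ, MeasurableSet {B : (𝒦 Z t).Λ → ℝ | ∀ Y ∈ Dfam Z t, emb Z t φ B ∈ lam.sp1 Y})
    -- (3) Γ(σ) = G(σ)· (definitional; complex symmetry and σ-holomorphy are READ OFF the one operator below)
    (hlin : ∀ Z, ∀ t ∈ terms (θ.ℓ₆ + 1) (lam.m₃ + 1) Z, ∀ φ ∈ lam.sp2 Z, ∀ σ : TPt 4 (lam.n + 1) → ℂ, (∀ j, ‖σ j‖ ≤ Real.exp cp.κ₁) →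
      ∀ X : (𝒦 Z t).Λ ⊕ (𝒦 Z t).C₀ → ℝ, Γm Z t φ σ X = (𝒦 Z t).G2 σ (uOf Z t φ) *ᵥ fun j => (X j : ℂ))
    {γ₂ : ℝ} (hγ₂ : 0 ≤ γ₂)
    -- (3) uniform fibre bounds of the bond locations
    {m : ℕ}
    (hfibΛ : ∀ Z t (x : UT Nf), (Finset.univ.filter fun i => (𝒦 Z t).locΛ i = x).card ≤ m)
    (hfibN : ∀ Z t (x : UT Nf), (Finset.univ.filter fun j => (𝒦 Z t).locN j = x).card ≤ m)
    -- (3) THE REFERENCE RUNG ON THE TERMS OF THE STEP OF RECORD (the displayed hypothesis, n10-b's reference currency):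
    --     ONE admissible reference package `rf`, an accretivity radius `0 < R₁ < R`, print's two perturbative sources (p. 15:
    --     «O(1)e^{−⅓δ₀M} + O(α₀ + α₁)» against the reference positivity) as FOUR DIVISION-FREE THRESHOLDS, positive input
    --     rates and `η ≤ etaMax` of the W-walks package `rf.toWalkPackage R₁` (standard rate book: `κ_C = κ_C⋆`, `ρ′ = μ∕4`),
    --     `TermWalksRef` for the kernels of every term, round letters, and PRINT's TWO EXCHANGE THRESHOLDS for a `θ₀ > 0`
    (rf : RefPackage) (hrf : rf.Admissible) {R₁ : ℝ} (hR₁ : 0 < R₁) (hR₁R : R₁ < rf.R)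
    (hPσ : 8 * rf.KbarP * rf.cV₀ * Real.exp (-(rf.εP * rf.Rσ)) ≤ rf.m₀) (hP₁ : 8 * rf.KbarP * rf.cV₀ * R₁ ≤ rf.m₀ * rf.R)
    (hAσ : 8 * rf.KbarA * rf.cV * Real.exp (-(rf.εA * rf.Rσ)) ≤ rf.mA₀) (hA₁ : 8 * rf.KbarA * rf.cV * R₁ ≤ rf.mA₀ * rf.R)
    (hp : (rf.toWalkPackage R₁).PositiveRates) (hη : rf.η ≤ (rf.toWalkPackage R₁).etaMax) (hαR : α < R₁)
    -- (3) NODE A's KERNEL DATA READ OFF ONE OPERATOR PER TERM — print's `C*Δ_k(σ(Z),𝐔,𝐉)C` after the conditioning (2.5)–(2.6): block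
    --     reading, ONE expansion at `rf`'s full-precision letters, ONE positivity, geometry, symmetry, σ-holomorphy, dominations in `rf`
    (KK : (Z : TDom 4 (lam.n + 1)) → (t : Finset (TDom 4 ((θ.ℓ₆ + 1) * (lam.n + 1))) × Finset (TBond 4 (lam.m₃ + 1) ((θ.ℓ₆ + 1) * (lam.n + 1)))) →
      (TPt 4 (lam.n + 1) → ℂ) → E₃ → Matrix ((𝒦 Z t).Λ ⊕ (𝒦 Z t).C₀) ((𝒦 Z t).Λ ⊕ (𝒦 Z t).C₀) ℂ)
    (hKA2 : ∀ Z t σ u, (𝒦 Z t).A2 σ u = (KK Z t σ u).toBlocks₁₁)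
    (hKG2 : ∀ Z t σ u, (𝒦 Z t).G2 σ u
      = Matrix.fromCols (0 : Matrix (𝒦 Z t).Λ (𝒦 Z t).Λ ℂ) (KK Z t σ u).toBlocks₁₂ * invSqrt (KK Z t σ u))
    (hKloc : ∀ Z t i, (𝒦 Z t).locΛ i = (𝒦 Z t).locN (Sum.inl i))
    (hKX : ∀ Z, ∀ t ∈ terms (θ.ℓ₆ + 1) (lam.m₃ + 1) Z, (𝒦 Z t).X.Nonempty)
    (hKexp : ∀ Z, ∀ t ∈ terms (θ.ℓ₆ + 1) (lam.m₃ + 1) Z,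
      ∃ (W : Type) (T : W → (TPt 4 (lam.n + 1) → ℂ) → E₃ → Matrix ((𝒦 Z t).Λ ⊕ (𝒦 Z t).C₀) ((𝒦 Z t).Λ ⊕ (𝒦 Z t).C₀) ℂ)
        (SX : Set W) (A : W → ℝ) (D : W → UT Nf → UT Nf → ℝ) (ρ : ℝ),
        JointWalkExpansion cp (𝒦 Z t).locN (𝒦 Z t).locN (KK Z t) (𝒦 Z t).X rf.R rf.εP rf.kapP rf.KbarP T SX A D ρ)
    (hKacc : ∀ Z, ∀ t ∈ terms (θ.ℓ₆ + 1) (lam.m₃ + 1) Z, ∀ v : (𝒦 Z t).Λ ⊕ (𝒦 Z t).C₀ → ℂ,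
      rf.m₀ * ∑ i, ‖v i‖ ^ 2 ≤ (∑ i, star (v i) * (KK Z t 0 0 *ᵥ v) i).re)
    (hKfar : ∀ Z, ∀ t ∈ terms (θ.ℓ₆ + 1) (lam.m₃ + 1) Z, ∀ k, ∀ z ∈ (𝒦 Z t).X, rf.Rσ ≤ tdist1 Nf ((𝒦 Z t).locN k) z)
    (hKmult : ∀ Z, ∀ t ∈ terms (θ.ℓ₆ + 1) (lam.m₃ + 1) Z, ∀ x : UT Nf,
      (Finset.univ.filter fun k => (𝒦 Z t).locN k = x).card ≤ rf.nB)
    (hKdim : ν ≤ rf.dm)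
    (hKsym : ∀ Z, ∀ t ∈ terms (θ.ℓ₆ + 1) (lam.m₃ + 1) Z, ∀ φ ∈ lam.sp2 Z, ∀ σ : TPt 4 (lam.n + 1) → ℂ, (∀ j, ‖σ j‖ ≤ Real.exp cp.κ₁) →
      (KK Z t σ (uOf Z t φ)).IsSymm)
    (hKhol : ∀ Z, ∀ t ∈ terms (θ.ℓ₆ + 1) (lam.m₃ + 1) Z, ∀ φ ∈ lam.sp2 Z, ∀ k l,
      DifferentiableOn ℂ (fun σ => KK Z t σ (uOf Z t φ) k l) {σ : TPt 4 (lam.n + 1) → ℂ | ∀ j, σ j ∈ Metric.ball (0 : ℂ) (Real.exp cp.κ₁)})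
    (hεL : rf.εL ≤ rf.εP) (hκL : rf.kapL ≤ rf.kapP) (hKL : rf.KbarP ≤ rf.KbarL)
    (hεA : rf.εA ≤ rf.εP) (hκA : rf.kapA ≤ rf.kapP) (hKA : rf.KbarP ≤ rf.KbarA) (hmA : rf.mA₀ ≤ rf.m₀)
    {KG KCs θ₀ : ℝ} (hKG : (rf.toWalkPackage R₁).Kbar ≤ KG) (hKCs : 8 / rf.mA₀ ≤ KCs) (hθ₀ : 0 < θ₀)
    (hαsmall : α ≤ θ₀ * R₁ / (4 * (rf.toWalkPackage R₁).Kbar + 4))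
    (hRσlarge : Real.log ((4 * (rf.toWalkPackage R₁).Kbar + 4) / θ₀)
      / ((rf.toWalkPackage R₁).mu / 4 - (rf.toWalkPackage R₁).kapCStar) ≤ rf.Rσ)
    -- (3) rates below the package's κ_C⋆, and NODE A's letter ϑ (θ_Γ = θ_E = θ₀, K_Γ = K_G, K₀′ = K_Cs, θ_C derived)
    {kap kap' kap'' kap₂ ϑ : ℝ} (hkap'' : 0 < kap'') (hk1 : kap'' < kap') (hk2 : kap' < kap) (hk3 : kap < kap₂)
    (hk4 : kap₂ < (rf.toWalkPackage R₁).kapCStar) (hθ₀le : θ₀ ≤ ϑ)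
    (hθR1le : (m * (1 + 2 / (kap - kap')) ^ ν) * (m * (1 + 2 / (kap' - kap'')) ^ ν)
      * (θ₀ * KCs * KG
        + KG * (KCs * θ₀ * (m * (1 + 2 / ((rf.toWalkPackage R₁).kapCStar - kap₂)) ^ ν) * KCs * (m * (1 + 2 / (kap₂ - kap)) ^ ν)) * KG
        + KG * KCs * θ₀) ≤ ϑ)
    (hsmallKθ : KCs * (m * (1 + 2 / kap) ^ ν) * (ϑ * (m * (1 + 2 / kap'') ^ ν)) < 1)
    -- (3) the (2.24)–(2.25) smallness with `a₂₀ = 2·m′·α₄·M⁻⁴(1 + 32/(κ₁−1))⁴`; the eigenvalue bound of C is the NUMBER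
    --     `2∕m_{A,0} ≤ cE`; the form bound of Γ₀ is the NUMBER `g = B_Γ²c_V·m c₀(1,η)^ν∕(m_{A,0}∕2)`
    {cE : ℝ} (hc0 : 0 ≤ cE)
    (hcE : 2 / rf.mA₀ ≤ cE)
    (hαc : (2 * (ϑ * (m * (1 + 2 / kap'') ^ ν)) +
      (γ₂ + 2 * (m' * lam.c.α₄ * (lam.c.M ^ 4)⁻¹ * (1 + 32 / (lam.c.κ₁ - 1)) ^ 4))) * cE ≤ 1 / 2)
    (hsmall : (2 * (ϑ * (m * (1 + 2 / kap'') ^ ν)) +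
      (γ₂ + 2 * (m' * lam.c.α₄ * (lam.c.M ^ 4)⁻¹ * (1 + 32 / (lam.c.κ₁ - 1)) ^ 4))) * (1 + 2 * cE * (((rf.toWalkPackage R₁).BΓ * rf.cV) * ((rf.toWalkPackage R₁).BΓ * (m * B6.c0 1 rf.η ^ ν)) / (rf.mA₀ / 2))) ≤ 1 / 2)
    -- (3) constant matching, p. 17: `a ≤ γ₂ r_P²` and the volume factor with `w = 2·K₀(64,8)·α₄·#(⋃𝐃)`
    (hPa : a ≤ γ₂ * rP ^ 2)
    (hvol : ∀ Z, ∀ t ∈ terms (θ.ℓ₆ + 1) (lam.m₃ + 1) Z,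
      2 * (KCs * (m * (1 + 2 / kap) ^ ν) * (ϑ * (m * (1 + 2 / kap'') ^ ν))
              * (1 + (1 - KCs * (m * (1 + 2 / kap) ^ ν) * (ϑ * (m * (1 + 2 / kap'') ^ ν)))⁻¹) / 2)
          * (Fintype.card (𝒦 Z t).Λ : ℝ)
        + 2 * (K₀ 64 8 * lam.c.α₄ * ((((Dfam Z t).image Subtype.val).biUnion id).card : ℝ))
        + (2 * (ϑ * (m * (1 + 2 / kap'') ^ ν)) +
            (γ₂ + 2 * (m' * lam.c.α₄ * (lam.c.M ^ 4)⁻¹ * (1 + 32 / (lam.c.κ₁ - 1)) ^ 4))) * cE * (Fintype.card (𝒦 Z t).Λ : ℝ)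
        + (2 * (ϑ * (m * (1 + 2 / kap'') ^ ν)) +
            (γ₂ + 2 * (m' * lam.c.α₄ * (lam.c.M ^ 4)⁻¹ * (1 + 32 / (lam.c.κ₁ - 1)) ^ 4))) * (1 + 2 * cE * (((rf.toWalkPackage R₁).BΓ * rf.cV) * ((rf.toWalkPackage R₁).BΓ * (m * B6.c0 1 rf.η ^ ν)) / (rf.mA₀ / 2)))
            * (Fintype.card ((𝒦 Z t).Λ ⊕ (𝒦 Z t).C₀) : ℝ)
        ≤ a₅ * ((Z.1).card : ℝ)) :
    B13LeafOfRecord θ lam := by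
  -- the W-walks package of the reference package, its standard rate book, print's two thresholds ⇒ NODE O's exchange inequality
  -- NODE A's four per-term kernel letters READ OFF THE ONE OPERATOR (module 17 ∕ §0)
  have hwalks : ∀ Z, ∀ t ∈ terms (θ.ℓ₆ + 1) (lam.m₃ + 1) Z, TermWalksRef (𝒦 Z t) rf := fun Z t ht => by
    obtain ⟨W, T, SX, A, D, ρ, hK⟩ := hKexp Z t ht
    exact termWalksRef_of_conditionedBlocks_at (hKA2 Z t) (hKG2 Z t) (hKloc Z t) (hKX Z t ht) rf hrf hK (hKacc Z t ht)
      (hKfar Z t ht) (hKmult Z t ht) hKdim hεL hκL hKL hεA hκA hKA hmA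
  have hAs : ∀ Z, ∀ t ∈ terms (θ.ℓ₆ + 1) (lam.m₃ + 1) Z, ∀ φ ∈ lam.sp2 Z, ∀ σ : TPt 4 (lam.n + 1) → ℂ,
      (∀ j, ‖σ j‖ ≤ Real.exp cp.κ₁) → ((𝒦 Z t).A2 σ (uOf Z t φ)).IsSymm := fun Z t ht φ hφ σ hσ =>
    isSymm_A2_of_conditionedBlocks (hKA2 Z t) (hKsym Z t ht φ hφ σ hσ)
  have hAhol : ∀ Z, ∀ t ∈ terms (θ.ℓ₆ + 1) (lam.m₃ + 1) Z, ∀ φ ∈ lam.sp2 Z, ∀ i j,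
      DifferentiableOn ℂ (fun σ => (𝒦 Z t).A2 σ (uOf Z t φ) i j)
        {σ : TPt 4 (lam.n + 1) → ℂ | ∀ j, σ j ∈ Metric.ball (0 : ℂ) (Real.exp cp.κ₁)} := fun Z t ht φ hφ i j =>
    differentiableOn_A2_of_conditionedBlocks (hKA2 Z t) (hKhol Z t ht φ hφ) i j
  have hGhol : ∀ Z, ∀ t ∈ terms (θ.ℓ₆ + 1) (lam.m₃ + 1) Z, ∀ φ ∈ lam.sp2 Z, ∀ i j,
      DifferentiableOn ℂ (fun σ => (𝒦 Z t).G2 σ (uOf Z t φ) i j)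
        {σ : TPt 4 (lam.n + 1) → ℂ | ∀ j, σ j ∈ Metric.ball (0 : ℂ) (Real.exp cp.κ₁)} := fun Z t ht φ hφ i j => by
    obtain ⟨W, T, SX, A, D, ρ, hK⟩ := hKexp Z t ht
    exact differentiableOn_G2_of_conditionedBlocks (hKG2 Z t) rf hrf hK (hKacc Z t ht) (hKfar Z t ht) (hKmult Z t ht) hKdim
      hR₁.le hR₁R hPσ hP₁ ((huα Z t ht φ hφ).trans hαR.le) (hKhol Z t ht φ hφ) i j
  have hq : (rf.toWalkPackage R₁).Admissible := RefPackage.admissible_toWalkPackage hrf hR₁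
  have hpos := WalkPackage.stdRates_pos (rf.toWalkPackage R₁) hq hp hη
  have hθ : 2 * (rf.toWalkPackage R₁).Kbar *
      (Real.exp (-((((rf.toWalkPackage R₁).stdRates hq hp hη).ρ' - ((rf.toWalkPackage R₁).stdRates hq hp hη).κC) *
        (rf.toWalkPackage R₁).Rσ)) + α / (rf.toWalkPackage R₁).R) ≤ θ₀ :=
    exchange_of_thresholds hq ((rf.toWalkPackage R₁).stdRates hq hp hη) hpos.2.1 hθ₀ hαsmall hRσlarge
  -- termwise domination at the step of record (H = Σ T₃, `termDomination_WtOfRecord`) chained with the dictionary `hT₃`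
  have hH : ∀ (Z : TDom 4 (lam.n + 1)) (φ : lam.Φ), φ ∈ lam.sp2 Z → ‖(WtOfRecord θ lam).H Z φ‖ ≤
      ∑ t ∈ terms (θ.ℓ₆ + 1) (lam.m₃ + 1) Z, ‖term214 r (lZ Z t) (lD Z t)
        (core214 (fun σ => (𝒦 Z t).A2 σ (uOf Z t φ)) (Γm Z t φ)
          (F214 t.2.card (χY₀ Z t) (χcP Z t) (Dfam Z t) (Vr Z t φ))) 0 0‖ := fun Z φ hφ =>
    (termDomination_WtOfRecord lam Z φ hφ).trans (Finset.sum_le_sum fun t ht => hT₃ Z t ht φ hφ)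
  exact b13Leaf_twoTorus_walksRefHolo (WtOfRecord θ lam) (c13OfRecord θ lam) lam.k hN12 hL8 rfl lam.S0 lam.F lam.Sq lam.SX
    lam.T lam.Sc lam.Sq' lam.SX' lam.T' dist (WtOfRecord_Vp lam) hS0Y hFsub hSq hScY hdist0 hdist hSX hSX' hX0
    (fun _ _ _ hf hg => lam.analytic_add hf hg) lam.analytic_zero hAnT hAnT' hK hK' hκ hδ1 hδκ hκ126 hκ126' hκ₁ hκ₁'
    hδ₀M hδ₀M5 hR8 hR9 h124 h130 hθ₁0 hθ₁1 hC lam.Gl (WtOfRecord_Vpp lam) hGlAn hGl lam.rd lam.e he (WtOfRecord_rd lam)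
    lam.s lam.Wf hg hK₂ hR hε3 hW hKW hcard (WtOfRecord_V lam) (fun Y φ b b' _ => WtOfRecord_Q lam Y φ b b') hsp
    (fun _ => rfl) hfloor hAnP hG (lam.m₃ + 1) hN h12 hE hε hC₁ hα hM hτ2 cp hκp hr hr1 𝒦 uOf hαnn
    huα lZ hlZ lD hlD Γm χY₀ χcP hχ0 hχ1 Pl hPcard hrP hχc Dfam Vr hH ιb hι cube hQsupp hfibc emb hBv hBv0 hVr hχsupp
    hAhol hGhol hχm hVm hsmallm hAs hlin hγ₂ hfibΛ hfibN rf hrf hR₁ hR₁R hPσ hP₁ hAσ hA₁ hp hη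
    ((rf.toWalkPackage R₁).stdRates hq hp hη) hpos.1 hpos.2.1.le hαR hwalks hKG hKCs hθ hkap'' hk1
    hk2 hk3 hk4 hθ₀le hθR1le hsmallKθ hc0 hcE hαc hsmall hPa hvol

end Group

end Summit.QuantumFields.YangMills.BalabanUVNodes.N10AtRecord11B13WalksBlockRefHolo

end
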